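import Summits.PneNP.PneNP.Theorems.ExpanderLinearGeneratorsGridRoutingOverlayDefs
import Summits.PneNP.PneNP.Theorems.ExpanderLinearGeneratorsGridRoutingSystem
import Literature.Computability.MetaComplexity.ScopeExpansion

/-!
# PneNP / ExpanderLinearGenerators — the overlaid grid routing system: supports, incidences,
unsolvability

Route `PneNP/ExpanderLinearGenerators`, support for crux stmt-PneNP-11443
(`LinearGeneratorDepthFregeHard`). For the grid routing system overlaid with a simple graph `G` on
`C` copies of its rows (`overlaySystem k C G`, `…GridRoutingOverlayDefs`):

* `supp_overlay_eq`, `mem_supp_overlay_inl/inr` — the support of row `(c, i)` is the grid support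
  of `i` (on copy `0` only) together with the edges of `G` at `(c, i)`;
* `card_supp_overlay_le` (`≤ 4 + deg`), `le_card_supp_overlay` (`≥ deg`);
* `card_filter_mem_supp_overlay` — every variable lies in exactly two equations (`0 < C`);
* `sum_ocharge`, `not_systemSat_overlaySystem` — total charge `1`, hence unsolvable.

References: E. Ben-Sasson, Comput. Complexity 11 (2002), §4 (hard expanding instances by
combining); A. Urquhart, X. Fu, NDJFL 37 (1996).
-/

namespace Summit.PneNP.PneNP.Theorems.GridRouting

set_option linter.dupNamespace false -- `Summit.PneNP.PneNP.…`: summit = sub-problem (D-0017)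

open Finset Literature.Computability.MetaComplexity

variable {k C : ℕ} {G : SimpleGraph (Fin C × Fin (nRows k))} [DecidableRel G.Adj]

/-- The numbered edge is an edge. [folklore] -/
theorem edgeOf_mem (e : Fin G.edgeFinset.card) : edgeOf k C G e ∈ G.edgeSet :=
  SimpleGraph.mem_edgeFinset.1 (edgeEnum k C G e).2

/-- `edgeOf` is injective. [folklore] -/
theorem edgeOf_injective : Function.Injective (edgeOf k C G) := fun _ _ h =>
  (edgeEnum k C G).injective (Subtype.ext h)

/-- Membership of a grid variable in a support. [folklore] -/
theorem mem_supp_overlay_inl (v : Fin C × Fin (nRows k)) (j : Fin (nVars k)) :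
    ovarEquiv k C G (Sum.inl j) ∈ (overlaySystem k C G (orowEquiv k C v)).supp ↔
      (v.1 : ℕ) = 0 ∧ j ∈ (gridSystem k v.2).supp := by
  simp only [LinEqMod.supp, overlaySystem, Equiv.symm_apply_apply, Finset.mem_filter,
    Finset.mem_univ, true_and, ocoef, ne_eq, ite_eq_right_iff, Classical.not_imp]

/-- Membership of an edge variable in a support. [folklore] -/
theorem mem_supp_overlay_inr (v : Fin C × Fin (nRows k)) (e : Fin G.edgeFinset.card) :
    ovarEquiv k C G (Sum.inr e) ∈ (overlaySystem k C G (orowEquiv k C v)).supp ↔ v ∈ edgeOf k C G e := by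
  simp only [LinEqMod.supp, overlaySystem, Equiv.symm_apply_apply, Finset.mem_filter,
    Finset.mem_univ, true_and, ocoef, ne_eq, ite_eq_right_iff, one_ne_zero, imp_false, not_not]

/-- The support of the equation of `v`, as a union of its grid part and its edge part. [folklore] -/
theorem supp_overlay_eq (v : Fin C × Fin (nRows k)) :
    (overlaySystem k C G (orowEquiv k C v)).supp =
      (Finset.univ.filter fun j : Fin (nVars k) => (v.1 : ℕ) = 0 ∧ j ∈ (gridSystem k v.2).supp).map
          ⟨fun j => ovarEquiv k C G (Sum.inl j), fun _ _ h => by simpa using h⟩ ∪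
        (Finset.univ.filter fun e : Fin G.edgeFinset.card => v ∈ edgeOf k C G e).map
          ⟨fun e => ovarEquiv k C G (Sum.inr e), fun _ _ h => by simpa using h⟩ := by
  ext x
  obtain ⟨y, rfl⟩ := (ovarEquiv k C G).surjective x
  rcases y with j | e
  · rw [mem_supp_overlay_inl]
    simp
  · rw [mem_supp_overlay_inr]
    simp

/-- The edges at `v`, counted through the enumeration, are `deg v` many. [folklore] -/
theorem card_filter_mem_edgeOf (v : Fin C × Fin (nRows k)) :
    (Finset.univ.filter fun e : Fin G.edgeFinset.card => v ∈ edgeOf k C G e).card = G.degree v := by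
  rw [← G.card_incidenceFinset_eq_degree v, G.incidenceFinset_eq_filter v]
  refine Finset.card_bij (fun e _ => edgeOf k C G e) ?_ ?_ ?_
  · intro e he
    rw [Finset.mem_filter] at he ⊢
    exact ⟨SimpleGraph.mem_edgeFinset.2 (edgeOf_mem e), he.2⟩
  · intro e₁ _ e₂ _ h
    exact edgeOf_injective h
  · intro s hs
    rw [Finset.mem_filter] at hs
    refine ⟨(edgeEnum k C G).symm ⟨s, hs.1⟩, ?_, ?_⟩
    · rw [Finset.mem_filter]
      refine ⟨Finset.mem_univ _, ?_⟩
      show v ∈ ((edgeEnum k C G ((edgeEnum k C G).symm ⟨s, hs.1⟩) : G.edgeFinset) : Sym2 _)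
      rw [Equiv.apply_symm_apply]
      exact hs.2
    · show ((edgeEnum k C G ((edgeEnum k C G).symm ⟨s, hs.1⟩) : G.edgeFinset) : Sym2 _) = s
      rw [Equiv.apply_symm_apply]

/-- The grid part of a support has at most `4` variables. [folklore] -/
theorem card_filter_gridPart_le (v : Fin C × Fin (nRows k)) :
    (Finset.univ.filter fun j : Fin (nVars k) => (v.1 : ℕ) = 0 ∧ j ∈ (gridSystem k v.2).supp).card
      ≤ 4 := by
  refine le_trans (Finset.card_le_card ?_) (card_supp_gridSystem_le k v.2)
  intro j hj
  exact (Finset.mem_filter.1 hj).2.2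

/-- **Supports have at most `4 + deg` variables** (`≤ 60` when `G` is `56`-regular). [folklore] -/
theorem card_supp_overlay_le (v : Fin C × Fin (nRows k)) :
    (overlaySystem k C G (orowEquiv k C v)).supp.card ≤ 4 + G.degree v := by
  rw [supp_overlay_eq]
  refine (Finset.card_union_le _ _).trans ?_
  rw [Finset.card_map, Finset.card_map, card_filter_mem_edgeOf]
  exact Nat.add_le_add_right (card_filter_gridPart_le v) _

/-- **Supports have at least `deg` variables.** [folklore] -/
theorem le_card_supp_overlay (v : Fin C × Fin (nRows k)) :
    G.degree v ≤ (overlaySystem k C G (orowEquiv k C v)).supp.card := by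
  rw [supp_overlay_eq, ← card_filter_mem_edgeOf v]
  refine le_trans ?_ (Finset.card_le_card Finset.subset_union_right)
  rw [Finset.card_map]

/-! ### Every variable lies in exactly two equations -/

omit [DecidableRel G.Adj] in
/-- Exactly two vertices lie on an edge. [folklore] -/
theorem card_filter_mem_sym2_of_mem_edgeSet {e : Sym2 (Fin C × Fin (nRows k))} (he : e ∈ G.edgeSet) :
    (Finset.univ.filter fun v => v ∈ e).card = 2 := by
  induction e using Sym2.ind with
  | h x y =>
    have hxy : x ≠ y := G.ne_of_adj he
    have : (Finset.univ.filter fun v => v ∈ s(x, y)) = {x, y} := by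
      ext v
      simp [Sym2.mem_iff]
    rw [this, Finset.card_pair hxy]

/-- A grid variable lies in exactly two grid equations (numbered form). [folklore] -/
theorem card_filter_mem_supp_gridSystem (j : Fin (nVars k)) :
    (Finset.univ.filter fun i : Fin (nRows k) => j ∈ (gridSystem k i).supp).card = 2 := by
  refine Eq.trans ?_ (card_filter_mem_edgesOf k ((varEquiv k).symm j))
  refine Finset.card_bij (fun i _ => (rowEquiv k).symm i) ?_ ?_ ?_
  · intro i hi
    rw [Finset.mem_filter] at hi ⊢
    refine ⟨Finset.mem_univ _, ?_⟩
    have h := hi.2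
    rw [← (rowEquiv k).apply_symm_apply i, supp_gridSystem, Finset.mem_map_equiv] at h
    exact h
  · intro i₁ _ i₂ _ h
    exact (rowEquiv k).symm.injective h
  · intro r hr
    rw [Finset.mem_filter] at hr
    refine ⟨rowEquiv k r, ?_, (rowEquiv k).symm_apply_apply r⟩
    rw [Finset.mem_filter, supp_gridSystem, Finset.mem_map_equiv]
    exact ⟨Finset.mem_univ _, hr.2⟩

/-- **Every variable of the overlaid system lies in exactly two equations.** [folklore] -/
theorem card_filter_mem_supp_overlay (hC : 0 < C) (x : Fin (OVars k C G)) :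
    (Finset.univ.filter fun i : Fin (ORows k C) => x ∈ (overlaySystem k C G i).supp).card = 2 := by
  -- count over the vertices `(c, i)` instead of the row numbers
  have key : (Finset.univ.filter fun i : Fin (ORows k C) => x ∈ (overlaySystem k C G i).supp).card =
      (Finset.univ.filter fun v : Fin C × Fin (nRows k) =>
        x ∈ (overlaySystem k C G (orowEquiv k C v)).supp).card := by
    refine Finset.card_bij (fun i _ => (orowEquiv k C).symm i) ?_ ?_ ?_
    · intro i hi
      rw [Finset.mem_filter] at hi ⊢
      exact ⟨Finset.mem_univ _, by rw [Equiv.apply_symm_apply]; exact hi.2⟩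
    · intro i₁ _ i₂ _ h
      exact (orowEquiv k C).symm.injective h
    · intro v hv
      rw [Finset.mem_filter] at hv
      exact ⟨orowEquiv k C v, by rw [Finset.mem_filter]; exact ⟨Finset.mem_univ _, hv.2⟩,
        (orowEquiv k C).symm_apply_apply v⟩
  rw [key]
  obtain ⟨y, rfl⟩ := (ovarEquiv k C G).surjective x
  rcases y with j | e
  · -- a grid variable: the two grid rows, on copy `0`
    simp_rw [mem_supp_overlay_inl]
    refine Eq.trans ?_ (card_filter_mem_supp_gridSystem j)
    refine Finset.card_bij (fun v _ => v.2) ?_ ?_ ?_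
    · intro v hv
      rw [Finset.mem_filter] at hv ⊢
      exact ⟨Finset.mem_univ _, hv.2.2⟩
    · intro v₁ hv₁ v₂ hv₂ h
      rw [Finset.mem_filter] at hv₁ hv₂
      exact Prod.ext (Fin.ext (by rw [hv₁.2.1, hv₂.2.1])) h
    · intro i hi
      rw [Finset.mem_filter] at hi
      exact ⟨(⟨0, hC⟩, i), by rw [Finset.mem_filter]; exact ⟨Finset.mem_univ _, rfl, hi.2⟩, rfl⟩
  · -- an edge variable: its two endpoints
    simp_rw [mem_supp_overlay_inr]
    exact card_filter_mem_sym2_of_mem_edgeSet (edgeOf_mem e)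

/-! ### Unsolvability -/

/-- The charges of the overlaid system sum to `1` (those of the grid, on copy `0`). [folklore] -/
theorem sum_ocharge (hC : 0 < C) : ∑ v : Fin C × Fin (nRows k), ocharge k C v = 1 := by
  rw [Fintype.sum_prod_type]
  have h0 : ∀ c : Fin C, ∑ i : Fin (nRows k), ocharge k C (c, i) =
      if (c : ℕ) = 0 then 1 else 0 := by
    intro c
    by_cases hc : (c : ℕ) = 0
    · simp only [ocharge, hc, if_true]
      rw [← sum_charge k, ← (rowEquiv k).sum_comp]
      refine Finset.sum_congr rfl fun r _ => ?_
      simp [gridSystem]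
    · simp [ocharge, hc]
  rw [Finset.sum_congr rfl fun c _ => h0 c, Finset.sum_boole]
  have : (Finset.univ.filter fun c : Fin C => (c : ℕ) = 0) = {⟨0, hC⟩} := by
    ext c; simp [Fin.ext_iff]
  rw [this, Finset.card_singleton, Nat.cast_one]

/-- **The overlaid system is unsolvable**: every variable is counted twice when all equations are
summed, while the charges sum to `1`. [Urquhart 1987, Lemma 4.1] [folklore] -/
theorem not_systemSat_overlaySystem (hC : 0 < C) : ¬ SystemSat (overlaySystem k C G) Finset.univ := by
  rintro ⟨z, hz⟩
  have hrow : ∀ i, ∑ x, (overlaySystem k C G i).1 x * z x = (overlaySystem k C G i).2 := fun i =>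
    hz i (Finset.mem_univ i)
  have hsum : ∑ i, ∑ x, (overlaySystem k C G i).1 x * z x = 1 := by
    rw [Finset.sum_congr rfl fun i _ => hrow i]
    have : ∑ i, (overlaySystem k C G i).2 = ∑ v, ocharge k C v := by
      rw [← (orowEquiv k C).sum_comp]
      refine Finset.sum_congr rfl fun v _ => ?_
      simp [overlaySystem]
    rw [this, sum_ocharge hC]
  have hcol : ∀ x, ∑ i, (overlaySystem k C G i).1 x = 0 := by
    intro x
    have hc : ∑ i, (overlaySystem k C G i).1 x =
        ∑ i, (if x ∈ (overlaySystem k C G i).supp then (1 : ZMod 2) else 0) := by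
      refine Finset.sum_congr rfl fun i _ => ?_
      by_cases h : x ∈ (overlaySystem k C G i).supp
      · rw [if_pos h]
        have hne : (overlaySystem k C G i).1 x ≠ 0 := by simpa [LinEqMod.supp] using h
        revert hne; generalize (overlaySystem k C G i).1 x = a; decide +revert
      · rw [if_neg h]
        simpa [LinEqMod.supp] using h
    rw [hc, Finset.sum_boole, card_filter_mem_supp_overlay hC x]
    decide
  rw [Finset.sum_comm] at hsum
  have h0 : ∑ x, ∑ i, (overlaySystem k C G i).1 x * z x = 0 := by
    refine Finset.sum_eq_zero fun x _ => ?_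
    rw [← Finset.sum_mul, hcol x, zero_mul]
  rw [h0] at hsum
  exact zero_ne_one hsum

end Summit.PneNP.PneNP.Theorems.GridRouting
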